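import Summits.ValiantsHypothesis.ValiantsHypothesis.Theorems.FeketeSOSFeketeSOSHardPaleyRIPDefs
import Mathlib.Analysis.SpecialFunctions.Pow.Real

/-!
# Route FeketeSOS — crux `FeketeSOSHard` (stmt-ValiantsHypothesis-3996), line `paley-rip`,
# stub `stub_paleyFlatRIP`: Chung-type SMALL-SET discrepancy (any `α < 1/2`) ⇒ flat discrepancy beyond `√p`

Bandeira–Mixon–Moreira (IMRN 2017, arXiv:1410.6457, Def. 2.1 / Thm 2.3) derive Paley RIP beyond the
square-root bottleneck from Chung's folklore conjecture (J. Number Theory 49 (1994), Conj. 2.2) in the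
form `PaleyDiscrepancy[α, β]`: character sums over all vertex sets of size `> p^α` save a power
`|S|^{−β}` over the trivial bound, for SOME `α < 1/2` (below `√p` only an `ε`-improvement of the
square-root barrier is asked).  This file records the corresponding step for the line's engine, in the
bilinear sum-graph format of `…FlatRIPConsequences.lean` / `…FlatOfDiscrepancy.lean`:

* `norm_charSum_le_card_mul_card` — the trivial bound `|Σ_{a∈A,b∈B} χ_p(a+b)| ≤ #A·#B`;
* `paleySumDiscrepancy_of_smallSetDiscrepancy` — if `∃ α < 1/2, β > 0` such that for all large `p` and
  all `A, B ⊆ [0,p)` with `#A, #B ≥ p^α`: `|Σ_{a∈A,b∈B} χ_p(a+b)| ≤ (#A·#B)^{1−β/2}` (a power saving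
  over trivial for all set pairs above `p^α`), then `PaleySumDiscrepancy` holds: `∃ κ, δ > 0` with
  `|Σ_{a∈A,b∈B} χ_p(a+b)| ≤ p^{1/2−κ} √(#A·#B)` for all large `p` and all `A, B ⊆ [0,p)` of size
  `≤ p^{1/2+δ}` (`κ = δ = min(β,1)/4 ∧ (1/2−α)/4`; pairs with a side below `p^α` are trivial).

With `flatRIP_of_paleySumDiscrepancy` (`…FlatOfDiscrepancy.lean`) this gives: Chung-type small-set
discrepancy at ANY exponent `α < 1/2` implies the registered engine `stub_paleyFlatRIP` — the line's
analogue of BMM17 Thm 2.3 (a) ⇒ (b).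

Honest framing: an implication between OPEN statements; the crux `FeketeSOSHard`, the engine and
`stub_tameReduction` remain open; nothing here bears on `VP ≠ VNP`.
-/

-- the line's namespace repeats a path segment by convention (same as the other paley-rip files)
set_option linter.dupNamespace false

namespace Summit.ValiantsHypothesis.ValiantsHypothesis.Theorems.FeketeSOSHardPaleyRIP

open Finset
open scoped BigOperators

noncomputable section

section SmallSet

/-- **Trivial bound.** `|Σ_{a∈A,b∈B} χ_p(a+b)| ≤ #A · #B` (`|χ_p| ≤ 1`). [folklore] -/
theorem norm_charSum_le_card_mul_card (p : ℕ) [Fact p.Prime] (A B : Finset ℕ) :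
    ‖∑ a ∈ A, ∑ b ∈ B, ((legendreSym p ((a : ℤ) + b) : ℤ) : ℂ)‖ ≤ (A.card : ℝ) * B.card := by
  have hchi : ∀ z : ℤ, ‖((legendreSym p z : ℤ) : ℂ)‖ ≤ 1 := by
    intro z
    rcases quadraticChar_isQuadratic (ZMod p) (z : ZMod p) with h | h | h <;>
      · unfold legendreSym; rw [h]; simp
  calc ‖∑ a ∈ A, ∑ b ∈ B, ((legendreSym p ((a : ℤ) + b) : ℤ) : ℂ)‖
      ≤ ∑ a ∈ A, ‖∑ b ∈ B, ((legendreSym p ((a : ℤ) + b) : ℤ) : ℂ)‖ := norm_sum_le _ _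
    _ ≤ ∑ a ∈ A, ∑ b ∈ B, (1 : ℝ) :=
        sum_le_sum fun a _ => (norm_sum_le _ _).trans (sum_le_sum fun b _ => hchi _)
    _ = (A.card : ℝ) * B.card := by simp

/-- **Small-set discrepancy at any exponent `α < 1/2` gives flat discrepancy beyond `√p`** (the
exponent step of Bandeira–Mixon–Moreira 2017, Thm 2.3 (a) ⇒ (b), in the line's bilinear sum format).
[folklore] -/
theorem paleySumDiscrepancy_of_smallSetDiscrepancy
    (hS : ∃ α : ℝ, α < 1 / 2 ∧ ∃ β : ℝ, 0 < β ∧ ∃ p₁ : ℕ, ∀ (p : ℕ) [Fact p.Prime], p₁ ≤ p →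
      ∀ (A B : Finset ℕ), (∀ a ∈ A, a < p) → (∀ b ∈ B, b < p) →
        (p : ℝ) ^ α ≤ (A.card : ℝ) → (p : ℝ) ^ α ≤ (B.card : ℝ) →
        ‖∑ a ∈ A, ∑ b ∈ B, ((legendreSym p ((a : ℤ) + b) : ℤ) : ℂ)‖ ≤
          ((A.card : ℝ) * B.card) ^ (1 - β / 2)) :
    ∃ κ : ℝ, 0 < κ ∧ ∃ δ : ℝ, 0 < δ ∧ ∃ p₁ : ℕ, ∀ (p : ℕ) [Fact p.Prime], p₁ ≤ p →
      ∀ (A B : Finset ℕ), (∀ a ∈ A, a < p) → (∀ b ∈ B, b < p) →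
        (A.card : ℝ) ≤ (p : ℝ) ^ (1 / 2 + δ) → (B.card : ℝ) ≤ (p : ℝ) ^ (1 / 2 + δ) →
        ‖∑ a ∈ A, ∑ b ∈ B, ((legendreSym p ((a : ℤ) + b) : ℤ) : ℂ)‖ ≤
          (p : ℝ) ^ (1 / 2 - κ) * Real.sqrt ((A.card : ℝ) * B.card) := by
  classical
  obtain ⟨α, hα, β₀, hβ₀, p₁, hS⟩ := hS
  -- cap the saving at `β ≤ 1`
  set β : ℝ := min β₀ 1 with hβdef
  have hβ : 0 < β := lt_min hβ₀ (by norm_num)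
  have hβle : β ≤ β₀ := min_le_left _ _
  have hβ1 : β ≤ 1 := min_le_right _ _
  -- the exponent gain
  set η : ℝ := min (β / 4) ((1 / 2 - α) / 4) with hηdef
  have hη : 0 < η := lt_min (by linarith) (by linarith)
  have hηβ : η ≤ β / 4 := min_le_left _ _
  have hηα : η ≤ (1 / 2 - α) / 4 := min_le_right _ _
  refine ⟨η, hη, η, hη, p₁, ?_⟩
  intro p _ hp A B hA hB hAc hBc
  have hprime : p.Prime := Fact.out
  have hp0 : (0 : ℝ) < (p : ℝ) := by exact_mod_cast hprime.pos
  have hp1 : (1 : ℝ) ≤ (p : ℝ) := by exact_mod_cast hprime.one_lt.le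
  set x : ℝ := (A.card : ℝ) with hx
  set y : ℝ := (B.card : ℝ) with hy
  have hx0 : 0 ≤ x := Nat.cast_nonneg _
  have hy0 : 0 ≤ y := Nat.cast_nonneg _
  have hxy0 : 0 ≤ x * y := mul_nonneg hx0 hy0
  have hsqrt_sq : Real.sqrt (x * y) * Real.sqrt (x * y) = x * y := Real.mul_self_sqrt hxy0
  have htriv := norm_charSum_le_card_mul_card p A B
  by_cases hbig : (p : ℝ) ^ α ≤ x ∧ (p : ℝ) ^ α ≤ y
  · -- both sides above `p^α`: use the small-set discrepancy
    have hpa : 0 < (p : ℝ) ^ α := Real.rpow_pos_of_pos hp0 α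
    have hxpos : 0 < x := lt_of_lt_of_le hpa hbig.1
    have hypos : 0 < y := lt_of_lt_of_le hpa hbig.2
    have hxy1 : 1 ≤ x * y := by
      have hA0 : 0 < A.card := by
        have h := hxpos
        rw [hx] at h
        exact_mod_cast h
      have hB0 : 0 < B.card := by
        have h := hypos
        rw [hy] at h
        exact_mod_cast h
      have h1 : (1 : ℝ) ≤ (A.card : ℝ) := by exact_mod_cast hA0
      have h2 : (1 : ℝ) ≤ (B.card : ℝ) := by exact_mod_cast hB0
      nlinarith
    have hmain := hS p hp A B hA hB hbig.1 hbig.2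
    have hmono : (x * y) ^ (1 - β₀ / 2) ≤ (x * y) ^ (1 - β / 2) :=
      Real.rpow_le_rpow_of_exponent_le hxy1 (by linarith)
    -- `(xy)^{1-β/2} = √(xy) · (xy)^{(1-β)/2} ≤ √(xy) · p^{(1+2η)(1-β)/2} ≤ √(xy) · p^{1/2-η}`
    have hsplit : (x * y) ^ (1 - β / 2) = (x * y) ^ ((1 - β) / 2) * Real.sqrt (x * y) := by
      rw [Real.sqrt_eq_rpow, ← Real.rpow_add (mul_pos hxpos hypos)]
      ring_nf
    have hxyle : x * y ≤ (p : ℝ) ^ (1 / 2 + η) * (p : ℝ) ^ (1 / 2 + η) :=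
      mul_le_mul hAc hBc hy0 (Real.rpow_nonneg hp0.le _)
    have hpow : (x * y) ^ ((1 - β) / 2) ≤ ((p : ℝ) ^ (1 / 2 + η) * (p : ℝ) ^ (1 / 2 + η)) ^ ((1 - β) / 2) :=
      Real.rpow_le_rpow hxy0 hxyle (by linarith)
    have hpp : ((p : ℝ) ^ (1 / 2 + η) * (p : ℝ) ^ (1 / 2 + η)) ^ ((1 - β) / 2) =
        (p : ℝ) ^ ((1 + 2 * η) * ((1 - β) / 2)) := by
      rw [← Real.rpow_add hp0, ← Real.rpow_mul hp0.le]
      ring_nf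
    have hexp : (1 + 2 * η) * ((1 - β) / 2) ≤ 1 / 2 - η := by nlinarith
    have hfin : (x * y) ^ ((1 - β) / 2) ≤ (p : ℝ) ^ (1 / 2 - η) := by
      rw [hpp] at hpow
      exact hpow.trans (Real.rpow_le_rpow_of_exponent_le hp1 hexp)
    calc ‖∑ a ∈ A, ∑ b ∈ B, ((legendreSym p ((a : ℤ) + b) : ℤ) : ℂ)‖
        ≤ (x * y) ^ (1 - β₀ / 2) := hmain
      _ ≤ (x * y) ^ (1 - β / 2) := hmono
      _ = (x * y) ^ ((1 - β) / 2) * Real.sqrt (x * y) := hsplit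
      _ ≤ (p : ℝ) ^ (1 / 2 - η) * Real.sqrt (x * y) :=
          mul_le_mul_of_nonneg_right hfin (Real.sqrt_nonneg _)
  · -- one side below `p^α`: the trivial bound suffices, `xy ≤ p^α · p^{1/2+η}`
    have hsmall : x * y ≤ (p : ℝ) ^ α * (p : ℝ) ^ (1 / 2 + η) := by
      rw [not_and_or] at hbig
      rcases hbig with h | h
      · push Not at h
        exact mul_le_mul h.le hBc hy0 (Real.rpow_nonneg hp0.le _)
      · push Not at h
        rw [mul_comm x y]
        exact mul_le_mul h.le hAc hx0 (Real.rpow_nonneg hp0.le _)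
    have hpp : (p : ℝ) ^ α * (p : ℝ) ^ (1 / 2 + η) = ((p : ℝ) ^ ((α + 1 / 2 + η) / 2)) ^ 2 := by
      rw [← Real.rpow_add hp0, ← Real.rpow_natCast, ← Real.rpow_mul hp0.le]
      congr 1
      push_cast
      ring
    have hsq : Real.sqrt (x * y) ≤ (p : ℝ) ^ ((α + 1 / 2 + η) / 2) := by
      rw [hpp] at hsmall
      exact (Real.sqrt_le_sqrt hsmall).trans (le_of_eq (Real.sqrt_sq (Real.rpow_nonneg hp0.le _)))
    have hexp : (α + 1 / 2 + η) / 2 ≤ 1 / 2 - η := by linarith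
    have hfin : Real.sqrt (x * y) ≤ (p : ℝ) ^ (1 / 2 - η) :=
      hsq.trans (Real.rpow_le_rpow_of_exponent_le hp1 hexp)
    calc ‖∑ a ∈ A, ∑ b ∈ B, ((legendreSym p ((a : ℤ) + b) : ℤ) : ℂ)‖ ≤ x * y := htriv
      _ = Real.sqrt (x * y) * Real.sqrt (x * y) := hsqrt_sq.symm
      _ ≤ (p : ℝ) ^ (1 / 2 - η) * Real.sqrt (x * y) :=
          mul_le_mul_of_nonneg_right hfin (Real.sqrt_nonneg _)

end SmallSet

end

end Summit.ValiantsHypothesis.ValiantsHypothesis.Theorems.FeketeSOSHardPaleyRIP
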